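import Literature.AlgebraicGeometry.Motives.CorrespondencesTraceFormula
import Literature.AlgebraicGeometry.Motives.FrobeniusTrace
import Literature.AlgebraicGeometry.Motives.FrobeniusMorphism
import HarnessLib

/-!
# The Lefschetz trace formula of a Weil cohomology theory, and the reduction of the
# Grothendieck–Lefschetz point-counting formula to the Frobenius correspondence

For a Weil cohomology theory `W : WeilCohomology k K` (Kleiman's axioms (A), (B), (C-lite),
`Literature.AlgebraicGeometry.Motives.WeilCohomology`) and `X` smooth projective of dimension `n`,
this file states and proves, from the axioms alone:

* `WeilCohomology.trace_cup_eq_sum_trace_of_isInducedBy` — **the Lefschetz trace formula for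
  correspondences** (Kleiman 1968, Prop. 1.3.6; Milne, *Étale cohomology*, VI Thm. 12.3; Kahn 2020,
  §3.5): if a class `u ∈ H²ⁿ(X × X)` induces the endomorphisms `G_a` of `Hᵃ(X)` (`0 ≤ a ≤ 2n`, in
  Kleiman's pairing form `W.IsInducedBy`) and `Δ ∈ H²ⁿ(X × X)` induces the identity (as the class
  of the diagonal does, axiom `exists_isInducedBy_id`), then
  `tr_{X×X} (u ∪ Δ) = ∑_{a=0}^{2n} (-1)ᵃ Tr (G_a | Hᵃ(X))`.
  The computation is the one already carried out inside
  `WeilCohomology.exists_rat_trace_of_isAlgebraicOperator` (`CorrespondencesTraceFormula`): `Δ` is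
  the Künneth decomposition `∑ₐ (-1)ᵃ D_{bₐ}` (`eq_kunnethDiagonal_of_isInducedBy_id`) and
  `tr (u ∪ D_{bₐ}) = Tr (G_a)` (`trace_cup_kunnethDiagonalComponent`); here it is recorded as a
  named theorem for an arbitrary graded family `G`.
* `WeilCohomology.eq_of_isInducedBy` — a class in `H²ⁿ(X × X)` is determined by the
  endomorphisms of the `Hᵃ(X)` it induces (Kleiman §1.3; Poincaré duality on `X × X` and
  Künneth), so the classes entering the trace formula are unique.
* `WeilCohomology.trace_cup_eq_sum_trace_pullback` — the case `G_a = φ*` of an endomorphism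
  `φ : X ⟶ X` (Milne VI Thm. 12.3 as printed: `(Γ_φ · Δ) = ∑ (-1)ʳ Tr(φ | Hʳ(X))`, the left-hand
  side read cohomologically; a class inducing `φ*` exists by the axiom
  `exists_isInducedBy_pullback`).
* `WeilCohomology.trace_cup_self_eq_sum_finrank` — the case `φ = id`:
  `tr_{X×X} (Δ ∪ Δ) = ∑ₐ (-1)ᵃ dim Hᵃ(X)`, the self-intersection of the diagonal is the Euler
  characteristic (Milne VI, proof of Thm. 12.6, "(12.3) with `φ = id`").
* `GaloisWeilCohomology.hasLefschetzTraceFormula_of_isInducedBy` — for a Weil cohomology theory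
  with Galois action `E` over a finite field (`GaloisRealization`, `FrobeniusTrace`), the
  **point-counting trace formula `E.HasLefschetzTraceFormula` follows from two statements about the
  Frobenius correspondence**: for every smooth projective `X` and `m ≥ 1` there is a class
  `u_m ∈ H²ⁿ(X × X)` which (a) induces `Fᵐ = ρ(geomFrob)ᵐ` on every `Hᵃ(X)` and (b) has
  `tr_{X×X} (u_m ∪ Δ) = #X(𝔽_{q^m})`. This is exactly the architecture of the printed proofs for
  smooth projective varieties: Milne V Cor. 2.6 (proof, p. 197 of the held copy: `ν_m(X)` is the
  number of fixed points of `Fᵐ`, equal to `(Γ_{Fᵐ} · Δ)` since every point of `Γ_{Fᵐ} · Δ` has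
  multiplicity one) combined with VI Thm. 12.3, and VI Rem. 13.5 (p. 302: on `Hʳ(X̄)` the
  Frobenius endomorphism `F` and `(1 ⊗ f)*`, `f = (a ↦ a^q)`, are inverse, i.e. `F* = ρ(f⁻¹)` is
  the action of the *geometric* Frobenius element) — Deligne, *Weil I*, (1.5.1) with the
  dictionary (1.15). For `ℓ`-adic cohomology, (a) is the statement that the cycle class of the
  (transposed) graph of the `k`-linear Frobenius `F_{X/k}ᵐ` induces `(F_{X/k}ᵐ ⊗ 1)* = ρ(F)ᵐ`, and
  (b) that its intersection number with the diagonal is the number of `𝔽_{q^m}`-points; the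
  theorem isolates what remains to be supplied by a construction of `ℓ`-adic cohomology in order
  to discharge the named fact
  `Literature.AlgebraicGeometry.Motives.exists_galoisWeilCohomology_hasLefschetzTraceFormula`
  (`EllAdicWeilCohomology`), beyond the `GaloisWeilCohomology` structure itself.

* `GaloisWeilCohomology.hasLefschetzTraceFormula_of_frobeniusOver` — the same reduction with the
  Frobenius correspondence taken to be that of the `k`-linear `q`-Frobenius endomorphism
  `F_{X/k}` (`frobeniusOver`, file `FrobeniusMorphism`): the trace formula follows from
  (D) Deligne's dictionary `ρ(geomFrob) = F*` on all `Hᵃ(X)` ((1.15); Milne VI Rem. 13.5) and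
  (I) `tr (u ∪ Δ) = #{P ∈ X(k̄) | Fᵐ P = P}` for `u` inducing `(Fᵐ)*` (Milne VI 12.3 + V 2.6),
  using `pointCount_eq_card_fixedPoints_frobeniusOver` (`#X(𝔽_{q^m})` *is* the number of fixed
  points of `Fᵐ` on `X(k̄)`) and `PreWeilCohomology.pullback_pow`.

Everything here is a theorem proved from the structure fields; no named fact is introduced.

## References

* S. Kleiman, *Algebraic cycles and the Weil conjectures*, in Dix exposés sur la cohomologie des
  schémas (1968), Prop. 1.3.6. [Kleiman1968AlgebraicCycles]
* J. S. Milne, *Étale cohomology*, Princeton Univ. Press (2025 reissue, held copy; PDF pages):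
  V Thm. 2.5, Cor. 2.6 (pp. 196–197); VI Thm. 12.3, 12.4, 12.6 (pp. 298–299); VI Thm. 13.4,
  Rem. 13.5 (pp. 301–302). [Milne2025]
* P. Deligne, *La conjecture de Weil. I*, Publ. Math. IHÉS 43 (1974), (1.5.1) p. 275, (1.15)
  p. 279. [Deligne1974]
* B. Kahn, *Zeta and L-functions of varieties and motives* (2020), §3.5. [Kahn2020]

## Design notes

* Degrees and signs follow `CorrespondencesTraceFormula`: the hypotheses quantify over all
  `a + a' = 2n` (so only `a ≤ 2n` occurs), the conclusion is a sum over `Finset.range (2 * n + 1)`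
  with the sign `(-1 : K) ^ a`, the shape of `GaloisWeilCohomology.HasLefschetzTraceFormula`.
* Mathlib/Literature searches: `kunnethDiagonal`, `trace_cup_kunnethDiagonalComponent`,
  `eq_kunnethDiagonal_of_isInducedBy_id` (Literature, used); `LinearMap.trace_id`,
  `Int.cast_negOnePow_natCast`, `Finset.sum_range` (Mathlib, used). No declaration named
  `*[Ll]efschetz*[Tt]race*` existed in Mathlib or the tree besides `HasLefschetzTraceFormula`.
-/

universe u v

open CategoryTheory AlgebraicGeometry MonoidalCategory

noncomputable section

namespace Literature.AlgebraicGeometry.Motives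

namespace WeilCohomology

variable {k : Type u} [Field k] {K : Type v} [Field K] [CharZero K] (W : WeilCohomology k K)
variable {n : ℕ} {X : SchemeOver k}

/-- **A correspondence is determined by the maps it induces** (Kleiman 1968, §1.3: under
Poincaré duality and Künneth, `u ↦ (x ↦ pr₂₊ (pr₁* x ∪ u))` identifies `H²ⁿ(X × X)` with
`⨁ₐ End (Hᵃ(X))`; here only injectivity). If `u, v ∈ H²ⁿ(X × X)` induce the same endomorphism
`G_a` of `Hᵃ(X)` for every `a ≤ 2n`, then `u = v`: both pair identically with all external
products `pr₁* x ∪ pr₂* y` (`trace_cup_externalCup_of_isInducedBy`), which span `H•(X × X)`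
(`kunneth_induction`), and Poincaré duality on `X × X` concludes. In particular the classes `u`,
`Δ` in the trace formulas below are unique. [cite: Kleiman1968AlgebraicCycles, §1.3] -/
theorem eq_of_isInducedBy (hX : IsSmoothProjective n X) {u v : W.obj (X ⊗ X) (2 * n)}
    (G : ∀ a : ℕ, W.obj X a →ₗ[K] W.obj X a)
    (hu : ∀ (a a' : ℕ) (ha : a + a' = 2 * n),
      W.IsInducedBy n n u (G a) ha (show a + 2 * n + a' = 2 * (n + n) by omega))
    (hv : ∀ (a a' : ℕ) (ha : a + a' = 2 * n),
      W.IsInducedBy n n v (G a) ha (show a + 2 * n + a' = 2 * (n + n) by omega)) :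
    u = v := by
  have hXX := isSmoothProjective_tensor hX hX
  have H : 2 * n + 2 * n = 2 * (n + n) := by omega
  refine W.ext_cupPairing_left hXX H fun w ↦ ?_
  simp only [cupPairing_apply]
  induction w using W.kunneth_induction hX hX with
  | zero => simp
  | add w w' hw hw' => simp only [map_add, hw, hw']
  | ext a a' ha x y =>
    rw [W.trace_cup_externalCup_of_isInducedBy hX ha (hu a a' ha) H x y,
      W.trace_cup_externalCup_of_isInducedBy hX ha (hv a a' ha) H x y]

/-- **Lefschetz trace formula for correspondences** (Kleiman 1968, Prop. 1.3.6; Milne VI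
Thm. 12.3; Kahn 2020, §3.5). Let `X` be smooth projective of dimension `n`, let
`u ∈ H²ⁿ(X × X)` induce the endomorphism `G_a` of `Hᵃ(X)` for every `a ≤ 2n` (Kleiman's pairing
form `tr_X (G_a x ∪ y) = tr_{X×X} ((pr₁* x ∪ u) ∪ pr₂* y)`), and let `Δ ∈ H²ⁿ(X × X)` induce the
identity of every `Hᵃ(X)` (as the class of the diagonal does). Then
`tr_{X×X} (u ∪ Δ) = ∑_{a=0}^{2n} (-1)ᵃ Tr (G_a | Hᵃ(X))`.
Proof: `Δ = ∑ₐ (-1)ᵃ ∑ₛ pr₁* b_{a,s} ∪ pr₂* bₐˢ` for bases `bₐ` of `Hᵃ(X)` with Poincaré-dual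
classes `bₐˢ` (`eq_kunnethDiagonal_of_isInducedBy_id`), and
`tr (u ∪ ∑ₛ pr₁* bₛ ∪ pr₂* bˢ) = ∑ₛ tr_X (G_a bₛ ∪ bˢ) = Tr (G_a)`
(`trace_cup_kunnethDiagonalComponent`).
[cite: Kleiman1968AlgebraicCycles, Prop. 1.3.6] [cite: Milne2025, VI Thm. 12.3 (p. 298)] -/
theorem trace_cup_eq_sum_trace_of_isInducedBy (hX : IsSmoothProjective n X)
    {u Δ : W.obj (X ⊗ X) (2 * n)} (G : ∀ a : ℕ, W.obj X a →ₗ[K] W.obj X a)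
    (hG : ∀ (a a' : ℕ) (ha : a + a' = 2 * n),
      W.IsInducedBy n n u (G a) ha (show a + 2 * n + a' = 2 * (n + n) by omega))
    (hΔ : ∀ (a a' : ℕ) (ha : a + a' = 2 * n),
      W.IsInducedBy n n Δ (LinearMap.id : W.obj X a →ₗ[K] W.obj X a) ha
        (show a + 2 * n + a' = 2 * (n + n) by omega))
    (H : 2 * n + 2 * n = 2 * (n + n)) :
    W.trace (X ⊗ X) (n + n) (W.cup H u Δ) =
      ∑ a ∈ Finset.range (2 * n + 1), (-1 : K) ^ a * LinearMap.trace K (W.obj X a) (G a) := by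
  haveI := W.finite_obj hX
  rw [W.eq_kunnethDiagonal_of_isInducedBy_id hX hΔ, kunnethDiagonal, map_sum, map_sum,
    Finset.sum_range]
  refine Finset.sum_congr rfl fun a _ ↦ ?_
  rw [map_zsmul, map_zsmul,
    W.trace_cup_kunnethDiagonalComponent hX _ _ (hG a (2 * n - a) (by omega)) H, zsmul_eq_mul,
    Int.cast_negOnePow_natCast]

/-- **Lefschetz trace formula for an endomorphism** (Milne VI Thm. 12.3, as printed:
`(Γ_φ · Δ) = ∑_{r=0}^{2d} (-1)ʳ Tr (φ | Hʳ(X))`, with the left-hand side read cohomologically;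
Kleiman 1968, Prop. 1.3.6). For `φ : X ⟶ X` and a class `u ∈ H²ⁿ(X × X)` inducing `φ*` on every
`Hᵃ(X)` — such a class, rational algebraic (the class of the transposed graph `ᵗΓ_φ`), exists by
the axiom `exists_isInducedBy_pullback` — and `Δ` inducing the identity,
`tr_{X×X} (u ∪ Δ) = ∑_{a=0}^{2n} (-1)ᵃ Tr (φ* | Hᵃ(X))`.
[cite: Milne2025, VI Thm. 12.3 (p. 298)] [cite: Kleiman1968AlgebraicCycles, Prop. 1.3.6] -/
theorem trace_cup_eq_sum_trace_pullback (hX : IsSmoothProjective n X) (φ : X ⟶ X)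
    {u Δ : W.obj (X ⊗ X) (2 * n)}
    (hu : ∀ (a a' : ℕ) (ha : a + a' = 2 * n),
      W.IsInducedBy n n u (W.pullback φ a) ha (show a + 2 * n + a' = 2 * (n + n) by omega))
    (hΔ : ∀ (a a' : ℕ) (ha : a + a' = 2 * n),
      W.IsInducedBy n n Δ (LinearMap.id : W.obj X a →ₗ[K] W.obj X a) ha
        (show a + 2 * n + a' = 2 * (n + n) by omega))
    (H : 2 * n + 2 * n = 2 * (n + n)) :
    W.trace (X ⊗ X) (n + n) (W.cup H u Δ) =
      ∑ a ∈ Finset.range (2 * n + 1),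
        (-1 : K) ^ a * LinearMap.trace K (W.obj X a) (W.pullback φ a) :=
  W.trace_cup_eq_sum_trace_of_isInducedBy hX (fun a ↦ W.pullback φ a) hu hΔ H

/-- **The self-intersection of the diagonal is the Euler characteristic** (Milne VI, proof of
Thm. 12.6: "(12.3) with `φ = id` shows that `∑ (-1)ʳ dim Hʳ(X̄, ℚ_ℓ)` is equal to `(Δ · Δ)`";
Kleiman 1968, Prop. 1.3.6 with `u = Δ`). For `Δ ∈ H²ⁿ(X × X)` inducing the identity of every
`Hᵃ(X)`, `tr_{X×X} (Δ ∪ Δ) = ∑_{a=0}^{2n} (-1)ᵃ dim_K Hᵃ(X)`.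
[cite: Milne2025, VI Thm. 12.6 (proof, p. 299)] [cite: Kleiman1968AlgebraicCycles, Prop. 1.3.6] -/
theorem trace_cup_self_eq_sum_finrank (hX : IsSmoothProjective n X) {Δ : W.obj (X ⊗ X) (2 * n)}
    (hΔ : ∀ (a a' : ℕ) (ha : a + a' = 2 * n),
      W.IsInducedBy n n Δ (LinearMap.id : W.obj X a →ₗ[K] W.obj X a) ha
        (show a + 2 * n + a' = 2 * (n + n) by omega))
    (H : 2 * n + 2 * n = 2 * (n + n)) :
    W.trace (X ⊗ X) (n + n) (W.cup H Δ Δ) =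
      ∑ a ∈ Finset.range (2 * n + 1), (-1 : K) ^ a * (Module.finrank K (W.obj X a) : K) := by
  haveI := W.finite_obj hX
  rw [W.trace_cup_eq_sum_trace_of_isInducedBy hX (fun _ ↦ LinearMap.id) hΔ hΔ H]
  simp_rw [LinearMap.trace_id]

end WeilCohomology

namespace GaloisWeilCohomology

variable {k : Type u} [Field k] [Finite k] {K : Type v} [Field K] [CharZero K]
  {χ : Field.absoluteGaloisGroup k →* Kˣ} (E : GaloisWeilCohomology k K χ)

/-- **The point-counting trace formula from the Frobenius correspondence** (the architecture of
Milne V Cor. 2.6 (proof) with VI Thm. 12.3, VI Thm. 13.4 and Rem. 13.5; Deligne, *Weil I*,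
(1.5.1) with the dictionary (1.15); Grothendieck, Sém. Bourbaki 279). Let `E` be a Weil
cohomology theory with Galois action over the finite field `k = 𝔽_q`. Suppose that for every
smooth projective `X` of dimension `n` and every `m ≥ 1` there are classes
`u, Δ ∈ H²ⁿ(X × X)` such that

* `u` induces `Fᵐ = ρ(geomFrob k)ᵐ = (E.frobAction X a) ^ m` on every `Hᵃ(X)` — for `ℓ`-adic
  cohomology, `u` is the class of the transposed graph of the `k`-linear Frobenius `F_{X/k}ᵐ`,
  which induces `(F_{X/k}ᵐ ⊗ 1)*`, equal to the action of the geometric Frobenius element by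
  Milne VI Rem. 13.5 / Deligne (1.15);
* `Δ` induces the identity of every `Hᵃ(X)` (the class of the diagonal);
* `tr_{X×X} (u ∪ Δ) = #X(𝔽_{q^m})` — the intersection number `(Γ_{Fᵐ} · Δ)` is the number of
  fixed points of `Fᵐ`, every point of `Γ_{Fᵐ} · Δ` having multiplicity one (Milne V Cor. 2.6,
  proof).

Then `E` satisfies the Grothendieck–Lefschetz trace formula `E.HasLefschetzTraceFormula`:
`#X(𝔽_{q^m}) = ∑_{a=0}^{2n} (-1)ᵃ tr (Fᵐ | Hᵃ(X))`, by the Lefschetz trace formula for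
correspondences (`WeilCohomology.trace_cup_eq_sum_trace_of_isInducedBy`). This is the assembly
step, inside the axiomatics, of the trace-formula component of the named fact
`exists_galoisWeilCohomology_hasLefschetzTraceFormula` (`EllAdicWeilCohomology`).
[cite: Milne2025, V Cor. 2.6 (proof, p. 197), VI Thm. 12.3 (p. 298), VI Rem. 13.5 (p. 302)]
[cite: Deligne1974, (1.5.1) p. 275 and (1.15) p. 279] -/
theorem hasLefschetzTraceFormula_of_isInducedBy
    (h : ∀ ⦃n : ℕ⦄ ⦃X : SchemeOver k⦄, IsSmoothProjective n X → ∀ m : ℕ, 0 < m →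
      ∃ u Δ : E.obj (X ⊗ X) (2 * n),
        (∀ (a a' : ℕ) (ha : a + a' = 2 * n),
          E.IsInducedBy n n u (E.frobAction X a ^ m) ha
            (show a + 2 * n + a' = 2 * (n + n) by omega)) ∧
        (∀ (a a' : ℕ) (ha : a + a' = 2 * n),
          E.IsInducedBy n n Δ (LinearMap.id : E.obj X a →ₗ[K] E.obj X a) ha
            (show a + 2 * n + a' = 2 * (n + n) by omega)) ∧
        E.trace (X ⊗ X) (n + n) (E.cup (show 2 * n + 2 * n = 2 * (n + n) by omega) u Δ) =
          pointCount X m) :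
    E.HasLefschetzTraceFormula := by
  intro n X hX m hm
  obtain ⟨u, Δ, hu, hΔ, htr⟩ := h hX m hm
  rw [← htr]
  exact E.trace_cup_eq_sum_trace_of_isInducedBy hX (fun a ↦ E.frobAction X a ^ m) hu hΔ _

end GaloisWeilCohomology

/-! ## The trace formula from the Frobenius endomorphism `F_{X/k}` -/

section Reduction

variable {k : Type u} [Field k] {K : Type v} [Field K]

/-- Pull-back along the `m`-th power `fᵐ` of an endomorphism `f : X ⟶ X` (power taken in the monoid
`End X`, `End.of f ^ m`) is the `m`-th power of `f* : Hᵃ(X) → Hᵃ(X)` (functoriality). [folklore] -/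
theorem PreWeilCohomology.pullback_pow (W : PreWeilCohomology k K) {X : SchemeOver k} (f : X ⟶ X)
    (a m : ℕ) : W.pullback (End.of f ^ m).asHom a = W.pullback f a ^ m := by
  induction m with
  | zero =>
    rw [_root_.pow_zero, _root_.pow_zero, End.one_def, End.asHom, W.pullback_id]
    rfl
  | succ m ih =>
    rw [_root_.pow_succ, _root_.pow_succ', End.mul_def, End.asHom, W.pullback_comp]
    change W.pullback f a ∘ₗ W.pullback (End.of f ^ m).asHom a = _
    rw [ih]
    rfl

variable [Finite k] [CharZero K] {χ : Field.absoluteGaloisGroup k →* Kˣ}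
  (E : GaloisWeilCohomology k K χ)

/-- **The point-counting trace formula from the Frobenius endomorphism** — the form of
`hasLefschetzTraceFormula_of_isInducedBy` in which the Frobenius correspondence is the one of the
`k`-linear `q`-Frobenius `F = F_{X/k} : X ⟶ X` (`frobeniusOver`, `FrobeniusMorphism`). Suppose

* (D) **Deligne's dictionary** (Deligne, *Weil I*, (1.15): `F* = φ⁻¹` on `Hⁱ(X̄)`; Milne VI
  Rem. 13.5): on every `Hᵃ(X)` of a smooth projective `X` the geometric Frobenius element acts as
  pull-back by the Frobenius endomorphism, `ρ(geomFrob k) = F*`;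
* (I) **the Lefschetz number of `Fᵐ` is its number of fixed points** (Milne VI Thm. 12.3 with
  V Cor. 2.6 (proof): `(Γ_{Fᵐ} · Δ) = #{P ∈ X(k̄) | Fᵐ P = P}`, every fixed point having
  multiplicity one): for `u ∈ H²ⁿ(X × X)` inducing `(Fᵐ)*` on every `Hᵃ(X)` (such `u`, the class
  of `ᵗΓ_{Fᵐ}`, exists by the axiom `exists_isInducedBy_pullback` and is unique by
  `WeilCohomology.eq_of_isInducedBy`) and `Δ` inducing the identity,
  `tr_{X×X} (u ∪ Δ) = #{P ∈ X(k̄) | Fᵐ(P) = P}`.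

Then `E.HasLefschetzTraceFormula` holds: `(Fᵐ)* = (F*)ᵐ = ρ(geomFrob)ᵐ` (`pullback_pow`, (D)),
the number of fixed points of `Fᵐ` on `X(k̄)` is `#X(𝔽_{q^m})`
(`pointCount_eq_card_fixedPoints_frobeniusOver`), and `hasLefschetzTraceFormula_of_isInducedBy`
applies. For `ℓ`-adic cohomology (D) and (I) are theorems (SGA 4½ [Rapport], [Cycle]; Milne VI
§§12–13); they are exactly what a construction of `ℓ`-adic cohomology as a `GaloisWeilCohomology`
must supply to discharge `exists_galoisWeilCohomology_hasLefschetzTraceFormula`.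
[cite: Deligne1974, (1.15) p. 279 and (1.5.1) p. 275]
[cite: Milne2025, VI Thm. 12.3 (p. 298), VI Rem. 13.5 (p. 302), V Cor. 2.6 (proof, p. 197)] -/
theorem GaloisWeilCohomology.hasLefschetzTraceFormula_of_frobeniusOver
    (hρ : ∀ ⦃n : ℕ⦄ ⦃X : SchemeOver k⦄, IsSmoothProjective n X → ∀ a : ℕ,
      E.ρ X a (geomFrob k) = E.pullback (frobeniusOver X) a)
    (hfix : ∀ ⦃n : ℕ⦄ ⦃X : SchemeOver k⦄ (hX : IsSmoothProjective n X) (m : ℕ), 0 < m →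
      ∀ (u Δ : E.obj (X ⊗ X) (2 * n)),
        (∀ (a a' : ℕ) (ha : a + a' = 2 * n),
          E.IsInducedBy n n u (E.pullback (End.of (frobeniusOver X) ^ m).asHom a) ha
            (show a + 2 * n + a' = 2 * (n + n) by omega)) →
        (∀ (a a' : ℕ) (ha : a + a' = 2 * n),
          E.IsInducedBy n n Δ (LinearMap.id : E.obj X a →ₗ[K] E.obj X a) ha
            (show a + 2 * n + a' = 2 * (n + n) by omega)) →
        E.trace (X ⊗ X) (n + n) (E.cup (show 2 * n + 2 * n = 2 * (n + n) by omega) u Δ) =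
          Nat.card {P : AlgPoints X (AlgebraicClosure k) //
            (AlgPoints.map (frobeniusOver X))^[m] P = P}) :
    E.HasLefschetzTraceFormula := by
  refine E.hasLefschetzTraceFormula_of_isInducedBy fun n X hX m hm ↦ ?_
  obtain ⟨u, -, hu⟩ := E.exists_isInducedBy_pullback hX hX (End.of (frobeniusOver X) ^ m).asHom
  obtain ⟨Δ, -, hΔ⟩ := E.exists_isInducedBy_id hX
  have hF : ∀ a : ℕ, E.frobAction X a ^ m = E.pullback (End.of (frobeniusOver X) ^ m).asHom a := fun a ↦ by
    rw [E.pullback_pow, GaloisWeilCohomology.frobAction_def, hρ hX a]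
  refine ⟨u, Δ, fun a a' ha ↦ ?_, fun a a' ha ↦ hΔ a a' ha, ?_⟩
  · rw [hF a]
    exact hu a a' ha
  · rw [hfix hX m hm u Δ (fun a a' ha ↦ hu a a' ha) (fun a a' ha ↦ hΔ a a' ha),
      pointCount_eq_card_fixedPoints_frobeniusOver]

end Reduction

end Literature.AlgebraicGeometry.Motives

end
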